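import Literature.NumberTheory.Automorphic.UnitaryGroupCongruenceIwahoriFactorisation   -- ★ `isCompact_isOpen_comap_congruenceGL`
import Literature.NumberTheory.Automorphic.UnitaryGroupLineBorelRing                 -- ★ `LineRing.isClosed_unipotentU`
import HarnessLib

/-!
# F0 · P3c · line LH6 «StCharTS» — ROAD «JAC-LOC» pin (T5) «MODEL HAAR PINS»: `U(σ, Φ₃)(K)` and its unipotent radical `N` are locally compact; `N` carries a Haar measure
# (Casselman 1995 §1.4 Prop. 1.4.4; Weil 1965)

Cell `pub/hodgecm-mathlib`, crux H413 = `stmt-HodgeConjecture-24833` (lane `--supports … --as helper`); seat LH6-p03 (g5), road «JAC-LOC».  THEOREMS ONLY; no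
definition ∕ instance ∕ notation ∕ named fact ∕ `sorry`.  HONEST LABEL: count-neutral plumbing for (J6) ED. 2 (the instance ∕ measure binders `μN`,
`[μN.IsHaarMeasure]` of ★ (J4b) `…SandwichMeasure` and ★ (J6-M) p851901 `…LevelPackage.orbit_and_mass_of_small_level` at the one-place model); closes no organ.
HC_CM is proved only modulo the 7 printed citations (2 remaining: hLiu418 = `stmt-HodgeConjecture-24832`, h413 = `stmt-HodgeConjecture-24833`) until rung 0 closes.

* `locallyCompactSpace_unitaryGroupOfForm` — `U′ = U(σ, J)(K)` over a non-archimedean local field is locally compact (the compact open subgroup `K_1 ∩ U′`, ★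
  `isCompact_isOpen_comap_congruenceGL`, is a compact neighbourhood of `1`);
* `locallyCompactSpace_unipotentU` — so is the closed subgroup `N` (★ `LineRing.isClosed_unipotentU`);
* `exists_isHaarMeasure_unipotentU` — hence `N` carries a Haar measure for the Borel σ-algebra (Mathlib `MeasureTheory.Measure.haar`).

## References
* [Casselman1995] W. Casselman, *Introduction to the theory of admissible representations of p-adic reductive groups* (1995), §1.4 Prop. 1.4.4.
* [Weil1965] A. Weil, *L'intégration dans les groupes topologiques et ses applications*, 2e éd. (1965), §7–§8 (Haar measure on locally compact groups).
-/

set_option autoImplicit false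
-- the mandated namespace has the single-problem summit's repeated segment (`HodgeConjecture.HodgeConjecture`)
set_option linter.dupNamespace false

noncomputable section

open MeasureTheory Measure Set Filter Topology
open scoped MatrixGroups
open Matrix ValuativeRel
open Literature.NumberTheory.Automorphic Literature.NumberTheory.Automorphic.UnitaryGroup

namespace Summit.HodgeConjecture.HodgeConjecture.Cruxes.H413.F0P3cStCharTSModelHaarPins

variable {K : Type*} [Field K] [ValuativeRel K] [TopologicalSpace K] [IsNonarchimedeanLocalField K]
  (σ : K →+* K) (J : Matrix (Fin 3) (Fin 3) K)

/-- **`U(σ, J)(K)` is locally compact**: `K_1 ∩ U′` is a compact open subgroup (★ `isCompact_isOpen_comap_congruenceGL`), hence a compact neighbourhood of `1`.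
[cite: Casselman1995, §1.4 Prop. 1.4.4] -/
theorem locallyCompactSpace_unitaryGroupOfForm (hσc : Continuous σ) : LocallyCompactSpace ↥(unitaryGroupOfForm σ J) := by
  obtain ⟨hc, ho⟩ := isCompact_isOpen_comap_congruenceGL σ (J := J) hσc (one_ne_zero : (1 : ValueGroupWithZero K) ≠ 0)
  exact hc.locallyCompactSpace_of_mem_nhds_of_group (ho.mem_nhds (Subgroup.one_mem _))

/-- **The unipotent radical `N ≤ U(σ, J)(K)` is locally compact** (closed in `U′`, ★ `LineRing.isClosed_unipotentU`). [cite: Casselman1995, §1.4 Prop. 1.4.4] -/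
theorem locallyCompactSpace_unipotentU (hσc : Continuous σ) : LocallyCompactSpace ↥(unipotentU σ J) := by
  haveI := locallyCompactSpace_unitaryGroupOfForm σ J hσc
  haveI : T2Space K := (Literature.NumberTheory.GaloisRepresentations.IsNonarchimedeanLocalField.isLocalField K).toT2Space
  have hcl : IsClosed (unipotentU σ J : Set ↥(unitaryGroupOfForm σ J)) := LineRing.isClosed_unipotentU σ J
  exact hcl.isClosedEmbedding_subtypeVal.locallyCompactSpace

/-- **`N` carries a Haar measure** (for the Borel σ-algebra): the binder `(μN : Measure ↥(unipotentU σ J)) [μN.IsHaarMeasure]` of ★ (J4b) ∕ ★ (J6-M) is inhabited.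
[cite: Weil1965, §7–§8] [cite: Casselman1995, §1.4 Prop. 1.4.4] -/
theorem exists_isHaarMeasure_unipotentU (hσc : Continuous σ) [MeasurableSpace ↥(unipotentU σ J)] [BorelSpace ↥(unipotentU σ J)] :
    ∃ μN : Measure ↥(unipotentU σ J), μN.IsHaarMeasure := by
  haveI := locallyCompactSpace_unipotentU σ J hσc
  exact ⟨Measure.haar, inferInstance⟩

/-- The same for `U′` itself: a Haar measure on `U(σ, J)(K)` exists for the Borel σ-algebra. [cite: Weil1965, §7–§8] -/
theorem exists_isHaarMeasure_unitaryGroupOfForm (hσc : Continuous σ) [MeasurableSpace ↥(unitaryGroupOfForm σ J)] [BorelSpace ↥(unitaryGroupOfForm σ J)] :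
    ∃ ν : Measure ↥(unitaryGroupOfForm σ J), ν.IsHaarMeasure := by
  haveI := locallyCompactSpace_unitaryGroupOfForm σ J hσc
  exact ⟨Measure.haar, inferInstance⟩

end Summit.HodgeConjecture.HodgeConjecture.Cruxes.H413.F0P3cStCharTSModelHaarPins

end
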